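import Literature.NumberTheory.Sieve.BombieriFriedlanderIwaniecTheorem7StarSwitchCells
import Literature.NumberTheory.Sieve.ShiuTheoremProofs
import HarnessLib

/-!
# Bombieri–Friedlander–Iwaniec 1986, Theorem 7* (§14): the ambiguous ranges of the `q ↔ s` switch

Topic `Literature/NumberTheory/Sieve`; continuation of `…Theorem7StarSwitchCells`.  Everything here is
PROVED; no named fact is introduced.

The subdivision argument of BFI §13 p. 241–242 ("we remove this dependence with an admissible error
term") leaves, for each cell, two short ambiguous ranges of `s'` (`BFI.ambCell`).  On them the
reduced complementary divisor `q̃` lies in two windows of relative length `δ` (the cell spread,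
`BFI.mem_ambiguous_windows_red`), so the total count is at most the number of solutions of
`P r q̃ ∣ h`, `h = l̃ m'' n'' − ã ≤ H`, `r ≤ R`, `q̃ ∈ J`.  This file bounds such counts: by
Cauchy–Schwarz against `∑ τ₃²` (`sum_mul_rho_le`), the second moment `∑_h ρ_J(h)²` being
`∑_{w, w'} ⌊H/lcm(w, w')⌋` (`sum_rhoJ_sq_eq`), and `∑ 1/lcm` is small because `J` is SHORT
(`sum_inv_lcm_le`): one factor `∑_{q ∈ J} τ(q)²/q ≪ δ log³` comes from Shiu's Brun–Titchmarsh theorem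
for `τ²` on short intervals (`Literature.NumberTheory.Sieve.Shiu1980BrunTitchmarsh_holds`), the
other factors are `τ(w)(1 + log R)` and `τ(w)(|J| + 2X)/X = O(τ(w))`.

## References

* E. Bombieri, J. B. Friedlander, H. Iwaniec, *Primes in arithmetic progressions to large moduli*,
  Acta Math. 156 (1986), 203–251: §13 p. 241–242. [BombieriFriedlanderIwaniecActa1986]
* P. Shiu, *A Brun–Titchmarsh theorem for multiplicative functions*, J. reine angew. Math. 313
  (1980), 161–170, Theorem 1. [Shiu1980]
-/

noncomputable section

open Finset Real

open scoped ArithmeticFunction.sigma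

namespace Literature.NumberTheory.Sieve

namespace BFI

/-! ### `gcd` sums -/

/-- `gcd(w, n) ≤ ∑_{d ∣ w, d ∣ n} d` (`w ≠ 0`). [folklore] -/
theorem gcd_le_sum_divisors {w : ℕ} (hw : w ≠ 0) (n : ℕ) :
    (Nat.gcd w n : ℝ) ≤ ∑ d ∈ w.divisors.filter (fun d => d ∣ n), (d : ℝ) := by
  have hmem : Nat.gcd w n ∈ w.divisors.filter (fun d => d ∣ n) :=
    Finset.mem_filter.2 ⟨Nat.mem_divisors.2 ⟨Nat.gcd_dvd_left w n, hw⟩, Nat.gcd_dvd_right w n⟩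
  rw [← Finset.sum_singleton (fun d : ℕ => (d : ℝ)) (Nat.gcd w n)]
  exact Finset.sum_le_sum_of_subset_of_nonneg (Finset.singleton_subset_iff.2 hmem) fun _ _ _ => by positivity

/-- The harmonic bound `∑_{k ≤ n} 1/k ≤ 1 + log n` (`n ≥ 1`), real form. [folklore] -/
theorem sum_Icc_inv_le_log (n : ℕ) (hn : 1 ≤ n) : ∑ k ∈ Icc 1 n, (1 : ℝ) / k ≤ 1 + Real.log n := by
  have h := harmonic_le_one_add_log n
  have e : ∀ m : ℕ, ∑ k ∈ Icc 1 m, (1 : ℝ) / k = ((harmonic m : ℚ) : ℝ) := by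
    intro m
    induction m with
    | zero => simp
    | succ m ih =>
      rw [Finset.sum_Icc_succ_top (by omega), ih, harmonic_succ]
      push_cast
      ring
  have hn' : (1 : ℝ) ≤ n := by exact_mod_cast hn
  rw [e]; exact_mod_cast h

/-- **`∑_{n ≤ R} gcd(w, n)/n ≤ τ(w) (1 + log R)`** (`w, R ≥ 1`). [folklore] -/
theorem sum_gcd_div_le {w : ℕ} (hw : w ≠ 0) {R : ℕ} (hR : 1 ≤ R) :
    ∑ n ∈ Icc 1 R, (Nat.gcd w n : ℝ) / n ≤ (σ 0 w : ℝ) * (1 + Real.log R) := by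
  calc ∑ n ∈ Icc 1 R, (Nat.gcd w n : ℝ) / n
      ≤ ∑ n ∈ Icc 1 R, ∑ d ∈ w.divisors, (if d ∣ n then (d : ℝ) / n else 0) := by
        refine Finset.sum_le_sum fun n hn => ?_
        have hn0 : (0 : ℝ) < n := by exact_mod_cast (Finset.mem_Icc.1 hn).1
        rw [div_le_iff₀ hn0, Finset.sum_mul]
        refine (gcd_le_sum_divisors hw n).trans (le_of_eq ?_)
        rw [Finset.sum_filter]
        refine Finset.sum_congr rfl fun d _ => ?_
        split_ifs
        · field_simp
        · simp
    _ = ∑ d ∈ w.divisors, ∑ n ∈ (Icc 1 R).filter (fun n => d ∣ n), (d : ℝ) / n := by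
        rw [Finset.sum_comm]
        exact Finset.sum_congr rfl fun d _ => by rw [Finset.sum_filter]
    _ ≤ ∑ d ∈ w.divisors, (1 + Real.log R) := by
        refine Finset.sum_le_sum fun d hd => ?_
        have hd0 : 0 < d := Nat.pos_of_mem_divisors hd
        -- multiples of `d` up to `R`: `n = d k`, `k ≤ R/d`
        have himg : (Icc 1 R).filter (fun n => d ∣ n) = (Icc 1 (R / d)).image (fun k => d * k) := by
          ext n
          simp only [Finset.mem_filter, Finset.mem_Icc, Finset.mem_image]
          constructor
          · rintro ⟨⟨h1, h2⟩, k, rfl⟩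
            refine ⟨k, ⟨?_, ?_⟩, rfl⟩
            · rcases Nat.eq_zero_or_pos k with hk | hk
              · subst hk; simp at h1
              · exact hk
            · rw [Nat.le_div_iff_mul_le hd0, mul_comm]; exact h2
          · rintro ⟨k, ⟨hk1, hk2⟩, rfl⟩
            refine ⟨⟨Nat.mul_pos hd0 hk1, ?_⟩, dvd_mul_right d k⟩
            rw [Nat.le_div_iff_mul_le hd0] at hk2; rw [mul_comm]; exact hk2
        rw [himg, Finset.sum_image (fun x _ y _ h => Nat.eq_of_mul_eq_mul_left hd0 h)]
        have e : ∀ k ∈ Icc 1 (R / d), (d : ℝ) / ((d * k : ℕ) : ℝ) = 1 / k := by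
          intro k hk
          have hk0 : (0 : ℝ) < k := by exact_mod_cast (Finset.mem_Icc.1 hk).1
          have hd0' : (0 : ℝ) < d := by exact_mod_cast hd0
          push_cast; field_simp
        rw [Finset.sum_congr rfl e]
        rcases Nat.eq_zero_or_pos (R / d) with h0 | h0
        · rw [h0]; simp
          have : 0 ≤ Real.log R := Real.log_nonneg (by exact_mod_cast hR)
          linarith
        · refine (sum_Icc_inv_le_log (R / d) h0).trans ?_
          have h1 : (1 : ℝ) ≤ (R / d : ℕ) := by exact_mod_cast h0
          have h2 : ((R / d : ℕ) : ℝ) ≤ R := by exact_mod_cast Nat.div_le_self R d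
          linarith [Real.log_le_log (by linarith) h2]
    _ = (σ 0 w : ℝ) * (1 + Real.log R) := by
        rw [Finset.sum_const, nsmul_eq_mul, ArithmeticFunction.sigma_zero_apply]

/-- Multiples of `d` in an interval: `#{q ∈ (A, B] : d ∣ q} = B/d − A/d ≤ (B − A)/d + 1`, in the form
`d · # ≤ (B − A) + d`. [folklore] -/
theorem mul_card_multiples_Ioc_le (d A B : ℕ) (hd : 0 < d) :
    d * ((Ioc A B).filter (fun q => d ∣ q)).card ≤ (B - A) + d := by
  have hsub : (Ioc A B).filter (fun q => d ∣ q) = (Ioc 0 B).filter (fun q => d ∣ q) \ (Ioc 0 A).filter (fun q => d ∣ q) := by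
    ext q; simp only [Finset.mem_filter, Finset.mem_Ioc, Finset.mem_sdiff]; constructor
    · rintro ⟨⟨h1, h2⟩, h3⟩; exact ⟨⟨⟨by omega, h2⟩, h3⟩, fun h => by omega⟩
    · rintro ⟨⟨⟨h1, h2⟩, h3⟩, h4⟩
      refine ⟨⟨?_, h2⟩, h3⟩
      by_contra hle; push Not at hle
      exact h4 ⟨⟨h1, hle⟩, h3⟩
  have hcard : ((Ioc A B).filter (fun q => d ∣ q)).card ≤ B / d - A / d := by
    rw [hsub]
    have h1 := Finset.card_sdiff_add_card_inter ((Ioc 0 B).filter (fun q => d ∣ q)) ((Ioc 0 A).filter (fun q => d ∣ q))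
    rw [Nat.Ioc_filter_dvd_card_eq_div B d] at h1
    by_cases hAB : A ≤ B
    · have hint : (Ioc 0 B).filter (fun q => d ∣ q) ∩ (Ioc 0 A).filter (fun q => d ∣ q) =
          (Ioc 0 A).filter (fun q => d ∣ q) := by
        ext q; simp only [Finset.mem_inter, Finset.mem_filter, Finset.mem_Ioc]
        constructor
        · rintro ⟨-, h⟩; exact h
        · rintro ⟨⟨h1, h2⟩, h3⟩; exact ⟨⟨⟨h1, by omega⟩, h3⟩, ⟨h1, h2⟩, h3⟩
      rw [hint, Nat.Ioc_filter_dvd_card_eq_div A d] at h1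
      omega
    · push Not at hAB
      have : (Ioc 0 B).filter (fun q => d ∣ q) \ (Ioc 0 A).filter (fun q => d ∣ q) = ∅ := by
        ext q; simp only [Finset.mem_sdiff, Finset.mem_filter, Finset.mem_Ioc, Finset.notMem_empty, iff_false]
        rintro ⟨⟨⟨h1, h2⟩, h3⟩, h4⟩; exact h4 ⟨⟨h1, by omega⟩, h3⟩
      rw [this]; simp
  have hdiv : d * (B / d - A / d) ≤ B - A + d := by
    rw [Nat.mul_sub]
    have h1 : d * (B / d) ≤ B := Nat.mul_div_le B d
    have h2 : A < d * (A / d) + d := by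
      have := Nat.lt_div_mul_add (a := A) hd; linarith [mul_comm d (A / d)]
    omega
  exact (Nat.mul_le_mul_left d hcard).trans hdiv

/-- **`∑_{q ∈ J} gcd(w, q) ≤ τ(w) (ℓ + 2X)`** for a union `J` of two intervals of total length `ℓ`
inside `(0, X]`. [folklore] -/
theorem sum_gcd_two_intervals_le {w : ℕ} (hw : w ≠ 0) {A₁ B₁ A₂ B₂ X : ℕ} (hB₁ : B₁ ≤ X) (hB₂ : B₂ ≤ X) :
    ∑ q ∈ Ioc A₁ B₁ ∪ Ioc A₂ B₂, (Nat.gcd w q : ℝ) ≤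
      (σ 0 w : ℝ) * (((B₁ - A₁ : ℕ) : ℝ) + ((B₂ - A₂ : ℕ) : ℝ) + 2 * X) := by
  have key : ∀ {A B : ℕ}, B ≤ X → ∑ q ∈ Ioc A B, (Nat.gcd w q : ℝ) ≤ (σ 0 w : ℝ) * (((B - A : ℕ) : ℝ) + X) := by
    intro A B hBX
    calc ∑ q ∈ Ioc A B, (Nat.gcd w q : ℝ)
        ≤ ∑ q ∈ Ioc A B, ∑ d ∈ w.divisors, (if d ∣ q then (d : ℝ) else 0) := by
          refine Finset.sum_le_sum fun q _ => (gcd_le_sum_divisors hw q).trans (le_of_eq ?_)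
          rw [Finset.sum_filter]
      _ = ∑ d ∈ w.divisors, (d : ℝ) * (((Ioc A B).filter (fun q => d ∣ q)).card : ℝ) := by
          rw [Finset.sum_comm]
          refine Finset.sum_congr rfl fun d _ => ?_
          rw [← Finset.sum_filter, Finset.sum_const, nsmul_eq_mul, mul_comm]
      _ ≤ ∑ d ∈ w.divisors, (((B - A : ℕ) : ℝ) + X) := by
          refine Finset.sum_le_sum fun d hd => ?_
          have hd0 : 0 < d := Nat.pos_of_mem_divisors hd
          by_cases hdX : d ≤ X
          · have := mul_card_multiples_Ioc_le d A B hd0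
            have h' : ((d * ((Ioc A B).filter (fun q => d ∣ q)).card : ℕ) : ℝ) ≤ ((B - A + d : ℕ) : ℝ) := by
              exact_mod_cast this
            push_cast at h'
            have hdX' : (d : ℝ) ≤ X := by exact_mod_cast hdX
            linarith
          · -- no multiple of `d > X` lies in `(A, B] ⊆ (0, X]`
            have : (Ioc A B).filter (fun q => d ∣ q) = ∅ := by
              ext q
              simp only [Finset.mem_filter, Finset.mem_Ioc, Finset.notMem_empty, iff_false]
              rintro ⟨⟨h1, h2⟩, h3⟩
              have := Nat.le_of_dvd (by omega) h3
              omega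
            rw [this]; simp; positivity
      _ = (σ 0 w : ℝ) * (((B - A : ℕ) : ℝ) + X) := by
          rw [Finset.sum_const, nsmul_eq_mul, ArithmeticFunction.sigma_zero_apply]
  calc ∑ q ∈ Ioc A₁ B₁ ∪ Ioc A₂ B₂, (Nat.gcd w q : ℝ)
      ≤ ∑ q ∈ Ioc A₁ B₁, (Nat.gcd w q : ℝ) + ∑ q ∈ Ioc A₂ B₂, (Nat.gcd w q : ℝ) := by
        rw [← Finset.union_sdiff_self_eq_union, Finset.sum_union Finset.disjoint_sdiff]
        have hle : ∑ q ∈ Ioc A₂ B₂ \ Ioc A₁ B₁, (Nat.gcd w q : ℝ) ≤ ∑ q ∈ Ioc A₂ B₂, (Nat.gcd w q : ℝ) :=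
          Finset.sum_le_sum_of_subset_of_nonneg Finset.sdiff_subset (fun q _ _ => by positivity)
        linarith
    _ ≤ (σ 0 w : ℝ) * (((B₁ - A₁ : ℕ) : ℝ) + X) + (σ 0 w : ℝ) * (((B₂ - A₂ : ℕ) : ℝ) + X) :=
        add_le_add (key hB₁) (key hB₂)
    _ = (σ 0 w : ℝ) * (((B₁ - A₁ : ℕ) : ℝ) + ((B₂ - A₂ : ℕ) : ℝ) + 2 * X) := by ring

/-! ### The second moment of the count of pairs `(r, q̃)` -/

/-- The pairs `(r, q̃)`, `1 ≤ r ≤ R`, `q̃ ∈ J`. [folklore] -/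
def pairsRJ (R : ℕ) (J : Finset ℕ) : Finset (ℕ × ℕ) := (Icc 1 R) ×ˢ J

/-- `ρ_J(h) = #{(r, q̃) : r ≤ R, q̃ ∈ J, P r q̃ ∣ h}`. [folklore] -/
def rhoJ (P R : ℕ) (J : Finset ℕ) (h : ℕ) : ℕ := ((pairsRJ R J).filter (fun p : ℕ × ℕ => P * p.1 * p.2 ∣ h)).card

/-- The number of multiples of `L` in `[1, H]` is `⌊H/L⌋ ≤ H/L` (real). [folklore] -/
theorem card_Icc_filter_dvd_le (L H : ℕ) :
    (((Icc 1 H).filter (fun h => L ∣ h)).card : ℝ) ≤ (H : ℝ) / L := by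
  have : (Icc 1 H) = Ioc 0 H := by ext h; simp [Finset.mem_Icc, Finset.mem_Ioc]; omega
  rw [this, Nat.Ioc_filter_dvd_card_eq_div H L]
  exact Nat.cast_div_le

/-- **`∑_{h ≤ H} ρ_J(h)² ≤ H ∑_{w, w'} 1/lcm(w, w')`** with `w = P r q̃` over the pairs. [folklore] -/
theorem sum_rhoJ_sq_le {P : ℕ} (hP : 0 < P) (R : ℕ) {J : Finset ℕ} (hJ : ∀ q ∈ J, 0 < q) (H : ℕ) :
    ∑ h ∈ Icc 1 H, ((rhoJ P R J h : ℕ) : ℝ) ^ 2 ≤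
      (H : ℝ) * ∑ p ∈ pairsRJ R J, ∑ p' ∈ pairsRJ R J,
        (1 : ℝ) / Nat.lcm (P * p.1 * p.2) (P * p'.1 * p'.2) := by
  -- `ρ(h)² = ∑_{p, p'} [w_p ∣ h][w_{p'} ∣ h]`
  have hsq : ∀ h : ℕ, ((rhoJ P R J h : ℕ) : ℝ) ^ 2 =
      ∑ p ∈ pairsRJ R J, ∑ p' ∈ pairsRJ R J,
        (if P * p.1 * p.2 ∣ h ∧ P * p'.1 * p'.2 ∣ h then (1 : ℝ) else 0) := by
    intro h
    unfold rhoJ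
    rw [Finset.card_filter, Nat.cast_sum, sq, Finset.sum_mul_sum]
    refine Finset.sum_congr rfl fun p _ => Finset.sum_congr rfl fun p' _ => ?_
    by_cases h1 : P * p.1 * p.2 ∣ h <;> by_cases h2 : P * p'.1 * p'.2 ∣ h <;> simp [h1, h2]
  rw [Finset.sum_congr rfl fun h _ => hsq h, Finset.sum_comm, Finset.mul_sum]
  refine Finset.sum_le_sum fun p hp => ?_
  rw [Finset.sum_comm, Finset.mul_sum]
  refine Finset.sum_le_sum fun p' hp' => ?_
  rw [← Finset.sum_filter, Finset.sum_const, nsmul_eq_mul, mul_one]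
  have hw : 0 < P * p.1 * p.2 := by
    rw [pairsRJ, Finset.mem_product, Finset.mem_Icc] at hp
    exact Nat.mul_pos (Nat.mul_pos hP hp.1.1) (hJ _ hp.2)
  have hw' : 0 < P * p'.1 * p'.2 := by
    rw [pairsRJ, Finset.mem_product, Finset.mem_Icc] at hp'
    exact Nat.mul_pos (Nat.mul_pos hP hp'.1.1) (hJ _ hp'.2)
  have hfilt : (Icc 1 H).filter (fun h => P * p.1 * p.2 ∣ h ∧ P * p'.1 * p'.2 ∣ h) =
      (Icc 1 H).filter (fun h => Nat.lcm (P * p.1 * p.2) (P * p'.1 * p'.2) ∣ h) := by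
    refine Finset.filter_congr fun h _ => ?_
    exact ⟨fun hh => Nat.lcm_dvd hh.1 hh.2, fun hh => ⟨(Nat.dvd_lcm_left _ _).trans hh, (Nat.dvd_lcm_right _ _).trans hh⟩⟩
  rw [hfilt, mul_one_div]
  exact card_Icc_filter_dvd_le _ H

/-- `1/lcm(P a, P b) = gcd(a, b)/(P a b)` for positive integers. [folklore] -/
theorem inv_lcm_mul_eq {P a b : ℕ} (hP : 0 < P) (ha : 0 < a) (hb : 0 < b) :
    (1 : ℝ) / Nat.lcm (P * a) (P * b) = (Nat.gcd a b : ℝ) / ((P : ℝ) * a * b) := by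
  rw [Nat.lcm_mul_left]
  have h := Nat.gcd_mul_lcm a b
  have hl : 0 < Nat.lcm a b := Nat.lcm_pos ha hb
  have hg : 0 < Nat.gcd a b := Nat.gcd_pos_of_pos_left b ha
  have h' : (Nat.gcd a b : ℝ) * (Nat.lcm a b : ℝ) = (a : ℝ) * b := by exact_mod_cast h
  have hP' : (0 : ℝ) < P := by exact_mod_cast hP
  have hl' : (0 : ℝ) < Nat.lcm a b := by exact_mod_cast hl
  rw [div_eq_div_iff (by positivity) (by positivity)]
  push_cast
  nlinarith [h']

/-- **`∑_{w, w'} 1/lcm(w, w')`** over the pairs is at most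
`(1/P) ∑_{(r,q)} (1/(rq)) (∑_{r'} gcd(rq, r')/r') (∑_{q'} gcd(rq, q')/q')`. [folklore] -/
theorem sum_sum_inv_lcm_le {P : ℕ} (hP : 0 < P) (R : ℕ) {J : Finset ℕ} (hJ : ∀ q ∈ J, 0 < q) :
    ∑ p ∈ pairsRJ R J, ∑ p' ∈ pairsRJ R J, (1 : ℝ) / Nat.lcm (P * p.1 * p.2) (P * p'.1 * p'.2) ≤
      (1 / (P : ℝ)) * ∑ p ∈ pairsRJ R J, (1 / ((p.1 : ℝ) * p.2)) *
        ((∑ r' ∈ Icc 1 R, (Nat.gcd (p.1 * p.2) r' : ℝ) / r') *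
          (∑ q' ∈ J, (Nat.gcd (p.1 * p.2) q' : ℝ) / q')) := by
  rw [Finset.mul_sum]
  refine Finset.sum_le_sum fun p hp => ?_
  rw [pairsRJ, Finset.mem_product, Finset.mem_Icc] at hp
  have hr : 0 < p.1 := hp.1.1
  have hq : 0 < p.2 := hJ _ hp.2
  rw [Finset.sum_mul_sum, pairsRJ, Finset.sum_product, Finset.mul_sum, Finset.mul_sum]
  refine Finset.sum_le_sum fun r' hr' => ?_
  rw [Finset.mul_sum, Finset.mul_sum]
  refine Finset.sum_le_sum fun q' hq' => ?_
  have hr'0 : 0 < r' := (Finset.mem_Icc.1 hr').1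
  have hq'0 : 0 < q' := hJ _ hq'
  rw [show P * p.1 * p.2 = P * (p.1 * p.2) by ring, show P * r' * q' = P * (r' * q') by ring,
    inv_lcm_mul_eq hP (Nat.mul_pos hr hq) (Nat.mul_pos hr'0 hq'0)]
  -- `gcd(rq, r'q') ≤ gcd(rq, r') gcd(rq, q')`
  have hgcd : (Nat.gcd (p.1 * p.2) (r' * q') : ℝ) ≤ (Nat.gcd (p.1 * p.2) r' : ℝ) * Nat.gcd (p.1 * p.2) q' := by
    have h := Nat.gcd_mul_right_dvd_mul_gcd (p.1 * p.2) r' q'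
    have hpos : 0 < Nat.gcd (p.1 * p.2) r' * Nat.gcd (p.1 * p.2) q' :=
      Nat.mul_pos (Nat.gcd_pos_of_pos_right _ hr'0) (Nat.gcd_pos_of_pos_right _ hq'0)
    exact_mod_cast Nat.le_of_dvd hpos h
  have hP' : (0 : ℝ) < P := by exact_mod_cast hP
  have hr1 : (0 : ℝ) < p.1 := by exact_mod_cast hr
  have hq1 : (0 : ℝ) < p.2 := by exact_mod_cast hq
  have hr'1 : (0 : ℝ) < r' := by exact_mod_cast hr'0
  have hq'1 : (0 : ℝ) < q' := by exact_mod_cast hq'0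
  calc (Nat.gcd (p.1 * p.2) (r' * q') : ℝ) / ((P : ℝ) * ((p.1 * p.2 : ℕ) : ℝ) * ((r' * q' : ℕ) : ℝ))
      ≤ ((Nat.gcd (p.1 * p.2) r' : ℝ) * Nat.gcd (p.1 * p.2) q') / ((P : ℝ) * ((p.1 * p.2 : ℕ) : ℝ) * ((r' * q' : ℕ) : ℝ)) :=
        div_le_div_of_nonneg_right hgcd (by positivity)
    _ = 1 / (P : ℝ) * (1 / ((p.1 : ℝ) * p.2) * ((Nat.gcd (p.1 * p.2) r' : ℝ) / r' * ((Nat.gcd (p.1 * p.2) q' : ℝ) / q'))) := by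
        push_cast; field_simp

/-- **The second moment**: for `J = (A₁, B₁] ∪ (A₂, B₂]` with all elements in `(Q₀, X]` (`Q₀ ≥ 1`),
`∑_{h ≤ H} ρ_J(h)² ≤ H (1 + log R)(ℓ + 2X)/(P Q₀) · (∑_{r ≤ R} τ(r)²/r)(∑_{q ∈ J} τ(q)²/q)`,
`ℓ = (B₁ − A₁) + (B₂ − A₂)`. [folklore] -/
theorem sum_rhoJ_sq_le_explicit {P : ℕ} (hP : 0 < P) {R : ℕ} (hR : 1 ≤ R) {A₁ B₁ A₂ B₂ Q₀ X : ℕ}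
    (hQ₀ : 0 < Q₀) (hA₁ : Q₀ ≤ A₁) (hA₂ : Q₀ ≤ A₂) (hB₁ : B₁ ≤ X) (hB₂ : B₂ ≤ X) (H : ℕ) :
    ∑ h ∈ Icc 1 H, ((rhoJ P R (Ioc A₁ B₁ ∪ Ioc A₂ B₂) h : ℕ) : ℝ) ^ 2 ≤
      (H : ℝ) * ((1 + Real.log R) * (((B₁ - A₁ : ℕ) : ℝ) + ((B₂ - A₂ : ℕ) : ℝ) + 2 * X) / ((P : ℝ) * Q₀)) *
        ((∑ r ∈ Icc 1 R, (σ 0 r : ℝ) ^ 2 / r) *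
          (∑ q ∈ Ioc A₁ B₁ ∪ Ioc A₂ B₂, (σ 0 q : ℝ) ^ 2 / q)) := by
  set J := Ioc A₁ B₁ ∪ Ioc A₂ B₂ with hJdef
  have hJpos : ∀ q ∈ J, 0 < q := by
    intro q hq
    rw [hJdef, Finset.mem_union, Finset.mem_Ioc, Finset.mem_Ioc] at hq
    rcases hq with h | h <;> omega
  have hJgt : ∀ q ∈ J, Q₀ < q := by
    intro q hq
    rw [hJdef, Finset.mem_union, Finset.mem_Ioc, Finset.mem_Ioc] at hq
    rcases hq with h | h <;> omega
  set ℓX := ((B₁ - A₁ : ℕ) : ℝ) + ((B₂ - A₂ : ℕ) : ℝ) + 2 * X with hℓX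
  have hℓX0 : 0 ≤ ℓX := by rw [hℓX]; positivity
  have hlogR : 0 ≤ 1 + Real.log R := by
    have := Real.log_nonneg (show (1 : ℝ) ≤ R by exact_mod_cast hR); linarith
  refine (sum_rhoJ_sq_le hP R hJpos H).trans ?_
  rw [mul_assoc]
  refine mul_le_mul_of_nonneg_left ((sum_sum_inv_lcm_le hP R hJpos).trans ?_) (Nat.cast_nonneg H)
  -- bound the two inner sums for each pair `(r, q)`
  have hinner : ∀ p ∈ pairsRJ R J, (1 / ((p.1 : ℝ) * p.2)) *
      ((∑ r' ∈ Icc 1 R, (Nat.gcd (p.1 * p.2) r' : ℝ) / r') * (∑ q' ∈ J, (Nat.gcd (p.1 * p.2) q' : ℝ) / q')) ≤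
      ((1 + Real.log R) * ℓX / Q₀) * ((σ 0 p.1 : ℝ) ^ 2 / p.1 * ((σ 0 p.2 : ℝ) ^ 2 / p.2)) := by
    intro p hp
    rw [pairsRJ, Finset.mem_product, Finset.mem_Icc] at hp
    have hr : 0 < p.1 := hp.1.1
    have hq : 0 < p.2 := hJpos _ hp.2
    have hw : p.1 * p.2 ≠ 0 := (Nat.mul_pos hr hq).ne'
    have h1 := sum_gcd_div_le hw hR
    have h2 : ∑ q' ∈ J, (Nat.gcd (p.1 * p.2) q' : ℝ) / q' ≤ (σ 0 (p.1 * p.2) : ℝ) * ℓX / Q₀ := by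
      have hQ₀' : (0 : ℝ) < Q₀ := by exact_mod_cast hQ₀
      calc ∑ q' ∈ J, (Nat.gcd (p.1 * p.2) q' : ℝ) / q' ≤ ∑ q' ∈ J, (Nat.gcd (p.1 * p.2) q' : ℝ) / Q₀ := by
            refine Finset.sum_le_sum fun q' hq' => ?_
            exact div_le_div_of_nonneg_left (by positivity) hQ₀' (by exact_mod_cast (hJgt q' hq').le)
        _ = (∑ q' ∈ J, (Nat.gcd (p.1 * p.2) q' : ℝ)) / Q₀ := by rw [Finset.sum_div]
        _ ≤ (σ 0 (p.1 * p.2) : ℝ) * ℓX / Q₀ :=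
            div_le_div_of_nonneg_right (sum_gcd_two_intervals_le hw hB₁ hB₂) hQ₀'.le
    have hτ : (σ 0 (p.1 * p.2) : ℝ) ≤ (σ 0 p.1 : ℝ) * σ 0 p.2 := by exact_mod_cast sigma_zero_mul_le p.1 p.2
    have hτ0 : (0 : ℝ) ≤ σ 0 (p.1 * p.2) := by positivity
    have hsum0 : 0 ≤ ∑ r' ∈ Icc 1 R, (Nat.gcd (p.1 * p.2) r' : ℝ) / r' :=
      Finset.sum_nonneg fun _ _ => by positivity
    have hsum0' : 0 ≤ ∑ q' ∈ J, (Nat.gcd (p.1 * p.2) q' : ℝ) / q' :=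
      Finset.sum_nonneg fun _ _ => by positivity
    have hr1 : (0 : ℝ) < p.1 := by exact_mod_cast hr
    have hq1 : (0 : ℝ) < p.2 := by exact_mod_cast hq
    calc (1 / ((p.1 : ℝ) * p.2)) *
          ((∑ r' ∈ Icc 1 R, (Nat.gcd (p.1 * p.2) r' : ℝ) / r') * (∑ q' ∈ J, (Nat.gcd (p.1 * p.2) q' : ℝ) / q'))
        ≤ (1 / ((p.1 : ℝ) * p.2)) * (((σ 0 (p.1 * p.2) : ℝ) * (1 + Real.log R)) * ((σ 0 (p.1 * p.2) : ℝ) * ℓX / Q₀)) := by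
          refine mul_le_mul_of_nonneg_left (mul_le_mul h1 h2 hsum0' (by positivity)) (by positivity)
      _ ≤ (1 / ((p.1 : ℝ) * p.2)) * ((((σ 0 p.1 : ℝ) * σ 0 p.2) * (1 + Real.log R)) * (((σ 0 p.1 : ℝ) * σ 0 p.2) * ℓX / Q₀)) := by
          refine mul_le_mul_of_nonneg_left ?_ (by positivity)
          have hQ₀' : (0 : ℝ) < Q₀ := by exact_mod_cast hQ₀
          refine mul_le_mul (mul_le_mul_of_nonneg_right hτ hlogR)
            (div_le_div_of_nonneg_right (mul_le_mul_of_nonneg_right hτ hℓX0) hQ₀'.le) (by positivity) (by positivity)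
      _ = ((1 + Real.log R) * ℓX / Q₀) * ((σ 0 p.1 : ℝ) ^ 2 / p.1 * ((σ 0 p.2 : ℝ) ^ 2 / p.2)) := by
          field_simp
  calc (1 / (P : ℝ)) * ∑ p ∈ pairsRJ R J, (1 / ((p.1 : ℝ) * p.2)) *
        ((∑ r' ∈ Icc 1 R, (Nat.gcd (p.1 * p.2) r' : ℝ) / r') * (∑ q' ∈ J, (Nat.gcd (p.1 * p.2) q' : ℝ) / q'))
      ≤ (1 / (P : ℝ)) * ∑ p ∈ pairsRJ R J,
          ((1 + Real.log R) * ℓX / Q₀) * ((σ 0 p.1 : ℝ) ^ 2 / p.1 * ((σ 0 p.2 : ℝ) ^ 2 / p.2)) :=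
        mul_le_mul_of_nonneg_left (Finset.sum_le_sum hinner) (by positivity)
    _ = ((1 + Real.log R) * ℓX / ((P : ℝ) * Q₀)) *
          ((∑ r ∈ Icc 1 R, (σ 0 r : ℝ) ^ 2 / r) * (∑ q ∈ J, (σ 0 q : ℝ) ^ 2 / q)) := by
        rw [← Finset.mul_sum, Finset.sum_mul_sum, pairsRJ, Finset.sum_product]
        field_simp

/-- **Cauchy–Schwarz for the ambiguous count**: `∑_h T(h) ρ_J(h) ≤ (∑_h T(h)²)^{1/2} (∑_h ρ_J(h)²)^{1/2}`.
[folklore] -/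
theorem sum_mul_rhoJ_le (T : ℕ → ℝ) (P R : ℕ) (J : Finset ℕ) (H : ℕ) :
    ∑ h ∈ Icc 1 H, T h * (rhoJ P R J h : ℝ) ≤
      Real.sqrt (∑ h ∈ Icc 1 H, T h ^ 2) * Real.sqrt (∑ h ∈ Icc 1 H, ((rhoJ P R J h : ℕ) : ℝ) ^ 2) :=
  Real.sum_mul_le_sqrt_mul_sqrt _ _ _

/-! ### Fibrewise form of the Cauchy–Schwarz step -/

/-- The multiplicity of the value `h` among `v(s)`, `s ∈ 𝒮`. [folklore] -/
def valMult {α : Type*} (𝒮 : Finset α) (v : α → ℕ) (h : ℕ) : ℕ := (𝒮.filter (fun s => v s = h)).card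

/-- `∑_{s ∈ 𝒮} F(v s) = ∑_{h ≤ H} T(h) F(h)` when all values lie in `[1, H]`. [folklore] -/
theorem sum_eq_sum_valMult {α : Type*} (𝒮 : Finset α) (v : α → ℕ) {H : ℕ} (hv : ∀ s ∈ 𝒮, v s ∈ Icc 1 H)
    (F : ℕ → ℝ) : ∑ s ∈ 𝒮, F (v s) = ∑ h ∈ Icc 1 H, (valMult 𝒮 v h : ℝ) * F h := by
  classical
  rw [← Finset.sum_fiberwise_of_maps_to (g := v) (fun s hs => hv s hs)]
  refine Finset.sum_congr rfl fun h _ => ?_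
  rw [Finset.sum_congr rfl fun s hs => by rw [(Finset.mem_filter.1 hs).2], Finset.sum_const, nsmul_eq_mul]
  rfl

/-- **`∑_{s ∈ 𝒮} ρ_J(v s) ≤ (∑_{s ∈ 𝒮} T(v s))^{1/2} (∑_{h ≤ H} ρ_J(h)²)^{1/2}`**, `T = valMult`. [folklore] -/
theorem sum_rhoJ_comp_le {α : Type*} (𝒮 : Finset α) (v : α → ℕ) {H : ℕ} (hv : ∀ s ∈ 𝒮, v s ∈ Icc 1 H)
    (P R : ℕ) (J : Finset ℕ) :
    ∑ s ∈ 𝒮, ((rhoJ P R J (v s) : ℕ) : ℝ) ≤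
      Real.sqrt (∑ s ∈ 𝒮, ((valMult 𝒮 v (v s) : ℕ) : ℝ)) *
        Real.sqrt (∑ h ∈ Icc 1 H, ((rhoJ P R J h : ℕ) : ℝ) ^ 2) := by
  rw [sum_eq_sum_valMult 𝒮 v hv (fun h => ((rhoJ P R J h : ℕ) : ℝ)),
    sum_eq_sum_valMult 𝒮 v hv (fun h => ((valMult 𝒮 v h : ℕ) : ℝ))]
  have e : ∑ h ∈ Icc 1 H, ((valMult 𝒮 v h : ℕ) : ℝ) * ((valMult 𝒮 v h : ℕ) : ℝ) =
      ∑ h ∈ Icc 1 H, ((valMult 𝒮 v h : ℕ) : ℝ) ^ 2 := Finset.sum_congr rfl fun h _ => by ring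
  rw [e]
  exact sum_mul_rhoJ_le _ P R J H

/-! ### Shiu's theorem on short intervals, for `τ²` -/

/-- **`∑_{A < q ≤ B} τ(q)² ≤ C max(B − A, √A) (log A)³`** for `x₀ ≤ A ≤ B ≤ 2A` (Shiu's Brun–Titchmarsh
theorem for `τ²` with modulus `1`). [cite: Shiu1980, Theorem 1] -/
theorem exists_sum_Ioc_sigma_zero_sq_le :
    ∃ C x₀ : ℝ, 0 < C ∧ ∀ A B : ℕ, x₀ ≤ (A : ℝ) → A ≤ B → B ≤ 2 * A →
      ∑ q ∈ Ioc A B, (σ 0 q : ℝ) ^ 2 ≤ C * max ((B : ℝ) - A) (Real.sqrt A) * Real.log A ^ 3 := by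
  obtain ⟨C, x₀, hC, h⟩ := Shiu1980BrunTitchmarsh_holds.sigma_zero_pow 2 (ε := 1 / 3) (θ := 1 / 3)
    (by norm_num) (by norm_num) (by norm_num) (by norm_num)
  refine ⟨C + 1, max x₀ 16, by positivity, fun A B hA hAB hB2 => ?_⟩
  have hx₀A : x₀ ≤ (A : ℝ) := le_trans (le_max_left _ _) hA
  have hA16 : (16 : ℝ) ≤ A := le_trans (le_max_right _ _) hA
  set y : ℝ := max ((B : ℝ) - A) (Real.sqrt A) with hy
  have hsqrt4 : (4 : ℝ) ≤ Real.sqrt A := by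
    rw [show (4 : ℝ) = Real.sqrt 16 by rw [show (16 : ℝ) = 4 ^ 2 by norm_num, Real.sqrt_sq (by norm_num)]]
    exact Real.sqrt_le_sqrt hA16
  have hy1 : (4 : ℝ) ≤ y := le_trans hsqrt4 (le_max_right _ _)
  have hy0 : 0 < y := by linarith
  have hAB' : (A : ℝ) ≤ B := by exact_mod_cast hAB
  have hB2' : (B : ℝ) ≤ 2 * A := by exact_mod_cast hB2
  -- the hypotheses of Shiu's theorem with `x = A`, `q = 1`
  have hxy1 : (A : ℝ) ^ (1 / 3 : ℝ) ≤ y := by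
    refine le_trans ?_ (le_max_right _ _)
    rw [Real.sqrt_eq_rpow]
    exact Real.rpow_le_rpow_of_exponent_le (by linarith) (by norm_num)
  have hxy2 : y ≤ A := by
    refine max_le (by linarith) ?_
    have hs : Real.sqrt A * Real.sqrt A = A := Real.mul_self_sqrt (by positivity)
    nlinarith
  have hq : ((1 : ℕ) : ℝ) < y ^ (1 - 1 / 3 : ℝ) := by
    have : (1 : ℝ) < y := by linarith
    calc ((1 : ℕ) : ℝ) = 1 := by norm_num
      _ < y ^ (1 - 1 / 3 : ℝ) := Real.one_lt_rpow this (by norm_num)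
  have hmain := h A y hx₀A hxy1 hxy2 1 le_rfl hq 0 (Nat.coprime_one_right 0)
  rw [Nat.totient_one, Nat.cast_one, div_one] at hmain
  -- our sum is part of Shiu's sum
  have hsub : Ioc A B ⊆ (Icc 1 ⌊(A : ℝ) + y⌋₊).filter (fun n : ℕ => (A : ℝ) < n ∧ (n : ZMod 1) = ((0 : ℕ) : ZMod 1)) := by
    intro n hn
    rw [Finset.mem_Ioc] at hn
    rw [Finset.mem_filter, Finset.mem_Icc]
    refine ⟨⟨by omega, ?_⟩, by exact_mod_cast hn.1, Subsingleton.elim _ _⟩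
    apply Nat.le_floor
    have : (n : ℝ) ≤ B := by exact_mod_cast hn.2
    have : (B : ℝ) - A ≤ y := le_max_left _ _
    linarith
  have hle : ∑ q ∈ Ioc A B, (σ 0 q : ℝ) ^ 2 ≤
      ∑ n ∈ (Icc 1 ⌊(A : ℝ) + y⌋₊).filter (fun n : ℕ => (A : ℝ) < n ∧ (n : ZMod 1) = ((0 : ℕ) : ZMod 1)),
        (σ 0 n : ℝ) ^ 2 :=
    Finset.sum_le_sum_of_subset_of_nonneg hsub fun _ _ _ => by positivity
  have hlog : 0 ≤ Real.log A := Real.log_nonneg (by linarith)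
  calc ∑ q ∈ Ioc A B, (σ 0 q : ℝ) ^ 2 ≤ C * y * Real.log A ^ (2 ^ 2 - 1) := hle.trans hmain
    _ = C * y * Real.log A ^ 3 := by norm_num
    _ ≤ (C + 1) * y * Real.log A ^ 3 := by gcongr; linarith

/-- `∑_{q ∈ J} τ(q)²/q ≤ (∑_{(A₁,B₁]} τ² + ∑_{(A₂,B₂]} τ²)/Q₀` when all elements of `J` exceed `Q₀`.
[folklore] -/
theorem sum_sigma_zero_sq_div_le {A₁ B₁ A₂ B₂ Q₀ : ℕ} (hQ₀ : 0 < Q₀) (hA₁ : Q₀ ≤ A₁) (hA₂ : Q₀ ≤ A₂) :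
    ∑ q ∈ Ioc A₁ B₁ ∪ Ioc A₂ B₂, (σ 0 q : ℝ) ^ 2 / q ≤
      (∑ q ∈ Ioc A₁ B₁, (σ 0 q : ℝ) ^ 2 + ∑ q ∈ Ioc A₂ B₂, (σ 0 q : ℝ) ^ 2) / Q₀ := by
  have hQ₀' : (0 : ℝ) < Q₀ := by exact_mod_cast hQ₀
  have hgt : ∀ q ∈ Ioc A₁ B₁ ∪ Ioc A₂ B₂, (Q₀ : ℝ) ≤ q := by
    intro q hq
    rw [Finset.mem_union, Finset.mem_Ioc, Finset.mem_Ioc] at hq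
    have : Q₀ ≤ q := by rcases hq with h | h <;> omega
    exact_mod_cast this
  calc ∑ q ∈ Ioc A₁ B₁ ∪ Ioc A₂ B₂, (σ 0 q : ℝ) ^ 2 / q
      ≤ ∑ q ∈ Ioc A₁ B₁ ∪ Ioc A₂ B₂, (σ 0 q : ℝ) ^ 2 / Q₀ := by
        refine Finset.sum_le_sum fun q hq => div_le_div_of_nonneg_left (by positivity) hQ₀' (hgt q hq)
    _ = (∑ q ∈ Ioc A₁ B₁ ∪ Ioc A₂ B₂, (σ 0 q : ℝ) ^ 2) / Q₀ := by rw [Finset.sum_div]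
    _ ≤ (∑ q ∈ Ioc A₁ B₁, (σ 0 q : ℝ) ^ 2 + ∑ q ∈ Ioc A₂ B₂, (σ 0 q : ℝ) ^ 2) / Q₀ := by
        refine div_le_div_of_nonneg_right ?_ hQ₀'.le
        rw [← Finset.union_sdiff_self_eq_union, Finset.sum_union Finset.disjoint_sdiff]
        have : ∑ q ∈ Ioc A₂ B₂ \ Ioc A₁ B₁, (σ 0 q : ℝ) ^ 2 ≤ ∑ q ∈ Ioc A₂ B₂, (σ 0 q : ℝ) ^ 2 :=
          Finset.sum_le_sum_of_subset_of_nonneg Finset.sdiff_subset (fun q _ _ => by positivity)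
        linarith

end BFI

end Literature.NumberTheory.Sieve
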